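import Literature.AlgebraicGeometry.AbelianSchemes.AbelianSchemeAmpleLocusOpen
import Literature.AlgebraicGeometry.AbelianSchemes.AbelianSchemeLDeltaFibreH1Vanishing
import HarnessLib

/-!
# The ample locus of `L^Δ(λ) = (1, λ)^*𝒫` is open: `λ̄ = Λ(𝒪(Θ))` with `Θ` ample at ONE geometric point (char. `0`) ⇒
# `L^Δ(λ)|_{A_ȳ} ≅ 𝒪(ample)` at EVERY field-valued `ȳ` over an open neighbourhood ([GortzWedhorn2023] Cor. 27.285, ampleness half)

Layer `Literature/AlgebraicGeometry/AbelianSchemes`, namespace `Literature.AlgebraicGeometry.AbelianSchemes.AbelianSchemeOver`.  THEOREMS ONLY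
(no definition, no named fact, no instance, no notation, no `sorry`); universe `Scheme.{0}`.  Cell `hodgecm-mathlib` (D-0151), P6 «MOD
programme», organ «AmpleLocusOpen» FILE 4 (glue for the consumer; B-p10 (g29)): ★ `AbelianSchemeAmpleLocusOpen` (FILE 3) read at
`L := L^Δ(λ) = Gr^*𝒫` for a homomorphism `λ : A → Â` with graph `Gr = (1, λ)` (the variable-with-two-projections convention of ★
`AbelianSchemeLDeltaOfLambda`), the witness at the geometric point being [MumfordFogartyKirwan1994] Def. 6.3's `λ̄ = Λ(𝒪(Θ))` (★
`IsLambdaOfAt`) with `Θ` AMPLE.  Consumer: ★ `PolarizationSpreadStage` §3 `exists_stage_polarization_of_isOpen_locus`, hypothesis `hopen`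
([GortzWedhorn2023] Cor. 27.285 shape): this file is its AMPLENESS HALF («`L^Δ(λ)` ample on every fibre near `x`»); the `IsLambdaOfAt` half
at the other points (square root of `Λ(L^Δ(λ)) = 2λ`, [GortzWedhorn2023] Prop. 27.284 ∕ [MumfordAV1970] §23, ★ `IsLambdaOfAtSquareRoot` in
characteristic `0`) is not in this file.  Count-neutral: HC_CM is proved only modulo the printed citations until rung 0 closes.

* **`exists_opens_forall_isAmple_iso_LDelta_of_isLambdaOfAt`** — `T` locally Noetherian, `𝒜/T` an abelian scheme with dual pair `D = (Â, 𝒫)`,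
  `λ : A → Â` with graph `Gr`, `x ∈ T`, `x̄ : Spec Ω → T` a geometric point centred at `x` with `Ω` algebraically closed of characteristic
  `0`, `Θ` ample on `A_x̄` with `λ̄_x̄ = Λ(𝒪(Θ))`.  THEN over an open `U ∋ x`, at every field-valued `ȳ` landing in `U` (any characteristic),
  `L^Δ(λ)|_{A_ȳ} ≅ 𝒪(Θ′)` with `Θ′` ample.  Proof: `[L^Δ(λ)|_{A_x̄}] = [Θ + (−1)^*Θ]` (★ `detClass_restrict_LDelta_eq_cechClass_add_pullback_neg`,
  [MumfordFogartyKirwan1994] Prop. 6.10), a SYMMETRIC AMPLE class ([GortzWedhorn2023] Rem. 27.185), so FILE 3 applies.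

## References
* [GortzWedhorn2023] U. Görtz, T. Wedhorn, *Algebraic Geometry II* (2023), Thm. 24.46 (p. 397), Cor. 27.285 (p. 723), Prop. 27.284,
  Rem. 27.185.
* [MumfordFogartyKirwan1994] D. Mumford, J. Fogarty, F. Kirwan, *Geometric Invariant Theory*, 3rd ed. (1994), Ch. 6 §2 Def. 6.3 (p. 120),
  Prop. 6.10 (p. 121).
* [EGAIII1] A. Grothendieck, J. Dieudonné, *EGA III₁* (1961), Thm. (4.7.1) (p. 145).
-/

noncomputable section

-- `Scheme.Modules` / `SheafOfModules` are not reducible (as in ★ `AbelianSchemeLDeltaFibreH1Vanishing`).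
set_option backward.isDefEq.respectTransparency false

open CategoryTheory CategoryTheory.Limits AlgebraicGeometry

namespace Literature.AlgebraicGeometry.AbelianSchemes

namespace AbelianSchemeOver

open Literature.AlgebraicGeometry.Modules Literature.AlgebraicGeometry.Motives Literature.AlgebraicGeometry.AbelianVarieties

variable {T : Scheme.{0}} [IsLocallyNoetherian T] (𝒜 : AbelianSchemeOver T) (D : 𝒜.DualPair) {lam : 𝒜.X ⟶ D.hat.X}
  (Gr : 𝒜.X.left ⟶ 𝒜.prodLeft D.hat) (hGr₁ : Gr ≫ pullback.fst 𝒜.X.hom D.hat.X.hom = 𝟙 _)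
  (hGr₂ : Gr ≫ pullback.snd 𝒜.X.hom D.hat.X.hom = lam.left)
  (x : T) {Ω : Type} [Field Ω] [IsAlgClosed Ω] [CharZero Ω] (xb : Spec (.of Ω) ⟶ T) (hx : x ∈ Set.range xb)
  {Θ : CartierDivisor (𝒜.fibre xb).toAbelianVariety.X.left} (hΘ : Θ.IsAmple) (hΛ : 𝒜.IsLambdaOfAt xb D lam Θ)

include hGr₁ hGr₂ hx hΘ hΛ in
/-- **THE AMPLE LOCUS OF `L^Δ(λ)` IS OPEN** ([GortzWedhorn2023] Cor. 27.285, ampleness half; Thm. 24.46 ∕ [EGAIII1] 4.7.1 for `A → T`):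
`T` locally Noetherian, `𝒜` an abelian scheme over `T` with dual pair `D`, `λ : A → Â` with graph `Gr = (1, λ)` (`hGr₁`, `hGr₂`), `x ∈ T`;
if at ONE geometric point `x̄ : Spec Ω → T` centred at `x` (`Ω` algebraically closed, characteristic `0`) `λ̄ = Λ(𝒪(Θ))` with `Θ` AMPLE
(★ `IsLambdaOfAt`), then there is an open `U ∋ x` such that at EVERY field-valued `ȳ : Spec Ω′ → T` landing in `U`,
`L^Δ(λ)|_{A_ȳ} = ȳ^*Gr^*𝒫 ≅ 𝒪(Θ′)` with `Θ′` AMPLE.  The witness for ★ `exists_opens_forall_isAmple_iso_lineBundleOfDivisor` is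
`Θ + (−1)^*Θ`: its class is `[L^Δ(λ)|_{A_x̄}]` (★ `detClass_restrict_LDelta_eq_cechClass_add_pullback_neg`), it is symmetric
(`(−1)^*` is an involution) and ample (★ `IsAmple.add`, ★ `IsAmple.pullback`).
[cite: GortzWedhorn2023, Cor. 27.285 (p. 723) and Rem. 27.185] [cite: MumfordFogartyKirwan1994, Ch. 6 §2 Prop. 6.10 (p. 121)]
[cite: EGAIII1, Thm. (4.7.1) p. 145] -/
theorem exists_opens_forall_isAmple_iso_LDelta_of_isLambdaOfAt :
    ∃ U : T.Opens, x ∈ U ∧ ∀ (Ω' : Type) [Field Ω'] (yb : Spec (.of Ω') ⟶ T), Set.range yb ⊆ (U : Set _) →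
      ∃ Θ' : CartierDivisor (𝒜.fibre yb).toAbelianVariety.X.left, Θ'.IsAmple ∧
        Nonempty ((Scheme.Modules.pullback (pullback.fst 𝒜.X.hom yb)).obj ((Scheme.Modules.pullback Gr).obj D.P) ≅
          𝒜.lineBundleOfDivisor yb Θ') := by
  let B := (𝒜.fibre xb).toAbelianVariety
  haveI : IsIntegral B.X.left :=
    haveI := B.geometricallyIntegral
    GeometricallyIntegral.isIntegral_of_subsingleton B.X.hom
  haveI : IsIntegral (pullback 𝒜.X.hom xb) := ‹IsIntegral B.X.left›
  -- the symmetric ample witness `Θ + (−1)^*Θ`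
  let ν : B.X.left ⟶ B.X.left := AbelianVariety.Hom.toSchemeHom (-𝟙 B)
  have hνν : ν ≫ ν = 𝟙 B.X.left := by
    change AbelianVariety.Hom.toSchemeHom ((-𝟙 B) ≫ (-𝟙 B)) = 𝟙 B.X.left
    rw [Preadditive.neg_comp_neg, Category.comp_id]
    rfl
  haveI : IsIso ν := ⟨ν, hνν, hνν⟩
  let Θs : CartierDivisor B.X.left := Θ + Θ.pullback ν
  have hsym : (Θs.pullback ν).LinEquiv Θs := by
    refine CartierDivisor.SameDivisor.linEquiv ?_
    refine (CartierDivisor.pullback_add_sameDivisor Θ (Θ.pullback ν) ν).trans ?_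
    refine CartierDivisor.SameDivisor.trans ?_ (CartierDivisor.add_comm_sameDivisor _ _)
    refine CartierDivisor.SameDivisor.add (CartierDivisor.SameDivisor.refl _) ?_
    refine (CartierDivisor.pullback_pullback_sameDivisor Θ ν ν).trans ?_
    exact (Θ.pullback_congr_sameDivisor hνν).trans Θ.pullback_id_sameDivisor
  have hamp : Θs.IsAmple := hΘ.add (hΘ.pullback ν)
  -- `L^Δ(λ)|_{A_x̄} ≅ 𝒪(Θ + (−1)^*Θ)` (classes in `Ȟ¹`)
  have hL : HasRank ((Scheme.Modules.pullback Gr).obj D.P) 1 := hasRank_pullback Gr D.hasRank_one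
  have hLf : IsFiniteLocallyFree
      ((Scheme.Modules.pullback (pullback.fst 𝒜.X.hom xb)).obj ((Scheme.Modules.pullback Gr).obj D.P)) :=
    (HasRank.isFiniteLocallyFree' hL).pullback _
  have e : Nonempty ((Scheme.Modules.pullback (pullback.fst 𝒜.X.hom xb)).obj ((Scheme.Modules.pullback Gr).obj D.P) ≅
      𝒜.lineBundleOfDivisor xb Θs) := by
    refine (nonempty_iso_iff_detClass_eq (hasRank_pullback _ hL) Θs.toUnitCocycle.hasRank_lineBundle hLf
      Θs.toUnitCocycle.isFiniteLocallyFree_lineBundle).2 ?_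
    rw [detClass_lineBundle_toUnitCocycle]
    exact 𝒜.detClass_restrict_LDelta_eq_cechClass_add_pullback_neg D xb rfl hΛ Gr hGr₁ hGr₂ hLf
  exact 𝒜.exists_opens_forall_isAmple_iso_lineBundleOfDivisor _ hL x xb hx hamp hsym e

end AbelianSchemeOver

end Literature.AlgebraicGeometry.AbelianSchemes

end
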